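import Literature.Computability.MetaComplexity.Resolution
import Literature.Computability.MetaComplexity.ResolutionProofs
import Literature.Computability.MetaComplexity.XorificationLift
import Literature.Computability.MetaComplexity.ResolutionRecords
import HarnessLib

/-!
# Atserias–Dalmau families and plays of Pudlák's game in (regular) resolution refutations

Trunk T-CPLX-META (proof complexity). Infrastructure for game-theoretic resolution lower
bounds over the tree's sequence-of-lines calculus (`Resolution.lean`: `IsResDerivation`,
`IsResRefutation`, `resWidth`, `IsRegular`, `IsDagPath`, `pivotsAlong`), written for the
discharge of `regularRefutation_xorify_size` (Bonacina 2017, Thm 8.2 at `δ = 0`,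
`XorificationProofs.lean`) and reusable for other Prover–Delayer arguments.

## Contents (all proved)

* `Falsifies α C`: the assignment recorded by its set `α` of true literals falsifies the
  set-clause `C`; `card_le_of_falsifies`; `lvars E` — the Finset of variables of a set of
  literals (the Finset form of `ResolutionRecords.MemVar`, bridge `mem_lvars_iff_memVar`;
  consistency of records is `ResolutionRecords.IsNonTaut`, with `IsNonTaut.insert` here).
* **Atserias–Dalmau families** (Atserias–Dalmau 2008, Def. 2, Lemma 2, Thm. 2; Bonacina 2017, Def. 2.3 and
  Thm 2.5, first half): `NarrowDerivable φ w C` — `C` is derivable within width `w` on top of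
  every width-`≤ w` derivation (the append-only formulation of `ResolutionProofs.lean`, which
  avoids re-indexing premises); `ADGood φ w α` — `α` falsifies no clause of `φ` and no narrowly
  derivable clause (eq. (2.19) of Bonacina 2017); `adGood_family` — if every refutation of
  `φ` has width `> w` then `ADGood φ w` contains `∅`, is closed under sub-assignments, is
  consistent with `φ`, and every member with `< w` literals extends by any variable
  (the Extension Property). Clauses of `φ` wider than `w` are allowed.
* **Plays** (Pudlák 2000; Bonacina 2017, Thm 8.4/8.5, proof sketch p. 120: "each play of the
  game corresponds to a path in `π`", records `α_C`): `lineD` (option-free line access),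
  `nextLine π ans k` / `trace π ans r₀ t` — the walk from line `r₀` towards the axioms in which
  the Delayer `ans` (a function of the current clause and the queried pivot) chooses the
  premise; `isDagPath_trace`; `pivotAt`; and for REGULAR refutations started at the empty
  clause: `pivotAt_ne` (no variable is queried twice — read-once), `persist` (a literal
  survives towards the root until its variable is resolved with the matching answer),
  `pivot_not_mem_clause` (the pivot is unassigned in the current record),
  `not_mem_clause_compl` / `isNonTaut_trace_clause` (records are assignments, `IsNonTaut`),
  `exists_query_of_mem` (records only
  contain answered literals), `clause_succ_subset` (`α_{i+1} ⊆ α_i ∪ {x = b}`).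

`resWidth_le_iff` is taken from `XorificationLift.lean`, `IsResDerivation.append_singleton` /
`isResDerivation_nil` from `ResolutionProofs.lean`, `IsNonTaut` / `MemVar` / `lineClause` from
`ResolutionRecords.lean` (bridges `mem_lvars_iff_memVar`, `lineClause_eq_lineD`,
`isNonTaut_trace_clause`).

## References

* A. Atserias, V. Dalmau, *A combinatorial characterization of resolution width*, J. Comput.
  Syst. Sci. 74 (2008) 323–334, Def. 2 (the families), Lemma 2 (the construction), Thm. 2
  (the characterization).
* I. Bonacina, *Space in Weak Propositional Proof Systems*, Springer 2017, Def. 2.3, Thm 2.5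
  (proof, eq. (2.19)), Thm 8.4, Thm 8.5 (proof sketch), §8.2.
* P. Pudlák, *Proofs as games*, Amer. Math. Monthly 107 (2000) 541–550.
* J. Krajíček, *Proof Complexity*, CUP 2019, §5.1 (paths in the proof graph), §5.6
  (regular resolution).
-/

namespace Literature.Computability.MetaComplexity

open Complexity

variable {ν : Type*} [DecidableEq ν]

/-- A (finite, partial) assignment, recorded as the set `α` of literals it makes TRUE,
falsifies the set-clause `C` iff it makes every literal of `C` false. [Atserias–Dalmau 2008, §2]
[folklore] -/
def Falsifies (α C : Finset (Literal ν)) : Prop :=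
  ∀ l ∈ C, l.negate ∈ α

omit [DecidableEq ν] in
/-- `negate` is an involution (dot-extension of G01's `Literal`, declared in its namespace
`Literature.CplxCore` on purpose). [folklore] -/
@[simp] theorem _root_.Literature.Computability.Complexity.Literal.negate_negate (l : Literal ν) : l.negate.negate = l := by
  rcases l with ⟨x, b⟩; simp [Literal.negate]

omit [DecidableEq ν] in
/-- `negate` is injective (dot-extension of G01's `Literal`). [folklore] -/
theorem _root_.Literature.Computability.Complexity.Literal.negate_injective : Function.Injective (Literal.negate (ν := ν)) :=
  fun l₁ l₂ h => by rw [← Literal.negate_negate l₁, h, Literal.negate_negate]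

/-- A falsified clause is no larger than the falsifying assignment. [folklore] -/
theorem card_le_of_falsifies {α C : Finset (Literal ν)} (h : Falsifies α C) : C.card ≤ α.card := by
  calc C.card = (C.image Literal.negate).card :=
        (Finset.card_image_of_injective C Literal.negate_injective).symm
    _ ≤ α.card := Finset.card_le_card fun m hm => by
        obtain ⟨l, hl, rfl⟩ := Finset.mem_image.1 hm
        exact h l hl

omit [DecidableEq ν] in
/-- Sub-assignments falsify fewer clauses. [folklore] -/
theorem Falsifies.mono {α β C : Finset (Literal ν)} (h : Falsifies β C) (hβα : β ⊆ α) :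
    Falsifies α C := fun l hl => hβα (h l hl)

section ADFamily

variable (φ : CNF ν) (w : ℕ)

/-- `C` is *narrowly derivable on top of everything*: every derivation from `φ` all of whose
lines have width `≤ w` extends to such a derivation containing the clause `C`. (The clauses
derivable within width `w`, in the append-only form of `ResolutionProofs.lean` that avoids
re-indexing premises.) [Atserias–Dalmau 2008, Lemma 2 (the set `𝒞`)] [folklore] -/
def NarrowDerivable (C : Finset (Literal ν)) : Prop :=
  ∀ π : List (ResLine ν), IsResDerivation φ π → resWidth π ≤ w →
    ∃ τ : List (ResLine ν), IsResDerivation φ (π ++ τ) ∧ resWidth (π ++ τ) ≤ w ∧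
      ∃ i, ∃ hi : i < (π ++ τ).length, ((π ++ τ)[i]'hi).clause = C

/-- The Atserias–Dalmau family of `φ` at width `w`: the assignments falsifying neither a
clause of `φ` nor a clause narrowly derivable from `φ`. [Atserias–Dalmau 2008, Def. 2 and Lemma 2;
Bonacina 2017, Thm 2.5, eq. (2.19)] [folklore] -/
def ADGood (α : Finset (Literal ν)) : Prop :=
  (∀ c ∈ φ, ¬ Falsifies α c.toFinset) ∧ ∀ C, NarrowDerivable φ w C → ¬ Falsifies α C

variable {φ w}

/-- Narrow initial clauses are narrowly derivable. [Atserias–Dalmau 2008, Lemma 2] [folklore] -/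
theorem narrowDerivable_of_mem {c : Clause ν} (hc : c ∈ φ) (hw : c.toFinset.card ≤ w) :
    NarrowDerivable φ w c.toFinset := by
  intro π hπ hπw
  refine ⟨[⟨c.toFinset, .initial⟩], hπ.append_singleton (List.mem_map.2 ⟨c, hc, rfl⟩), ?_, π.length,
    by simp, ?_⟩
  · rw [resWidth_le_iff] at hπw ⊢
    intro l hl
    rcases List.mem_append.1 hl with hl | hl
    · exact hπw l hl
    · rw [List.mem_singleton.1 hl]; exact hw
  · rw [List.getElem_append_right le_rfl]
    simp

/-- Narrow resolvents of narrowly derivable clauses are narrowly derivable.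
[Atserias–Dalmau 2008, Lemma 2] [folklore] -/
theorem narrowDerivable_of_isResolvent {C D E : Finset (Literal ν)} {v : ν}
    (hE : IsResolvent C D v E) (hC : NarrowDerivable φ w C) (hD : NarrowDerivable φ w D)
    (hEw : E.card ≤ w) : NarrowDerivable φ w E := by
  intro π hπ hπw
  obtain ⟨τ₁, h₁, h₁w, i, hi, hiC⟩ := hC π hπ hπw
  obtain ⟨τ₂, h₂, h₂w, j, hj, hjD⟩ := hD (π ++ τ₁) h₁ h₁w
  have hi₂ : i < (π ++ τ₁ ++ τ₂).length := by
    rw [List.length_append]; exact Nat.lt_of_lt_of_le hi (Nat.le_add_right _ _)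
  have hiC₂ : ((π ++ τ₁ ++ τ₂)[i]'hi₂).clause = C := by
    rw [List.getElem_append_left hi]; exact hiC
  have hval : IsValidResLine φ (π ++ τ₁ ++ τ₂) ⟨E, .resolve i j v⟩ := by
    change ∃ hi : i < (π ++ τ₁ ++ τ₂).length, ∃ hj : j < (π ++ τ₁ ++ τ₂).length,
      IsResolvent ((π ++ τ₁ ++ τ₂)[i]'hi).clause ((π ++ τ₁ ++ τ₂)[j]'hj).clause v E
    refine ⟨hi₂, hj, ?_⟩
    rw [hiC₂, hjD]; exact hE
  refine ⟨τ₁ ++ τ₂ ++ [⟨E, .resolve i j v⟩], ?_, ?_, (π ++ τ₁ ++ τ₂).length, ?_, ?_⟩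
  · simpa only [List.append_assoc] using h₂.append_singleton hval
  · rw [resWidth_le_iff] at h₂w ⊢
    intro l hl
    simp only [← List.append_assoc, List.mem_append, List.mem_singleton] at hl h₂w
    rcases hl with hl | rfl
    · exact h₂w l hl
    · exact hEw
  · simp
  · simp only [← List.append_assoc]
    rw [List.getElem_append_right le_rfl]
    simp

/-- The empty clause is not narrowly derivable if every refutation has width `> w`.
[Atserias–Dalmau 2008, Lemma 2] [folklore] -/
theorem not_narrowDerivable_empty
    (hwidth : ∀ π : List (ResLine ν), IsResRefutation φ π → w < resWidth π) :
    ¬ NarrowDerivable φ w ∅ := by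
  intro h
  obtain ⟨τ, hτ, hτw, i, hi, hiC⟩ := h [] (isResDerivation_nil φ) (by simp [resWidth])
  simp only [List.nil_append] at hτ hτw hi hiC
  have := hwidth τ ⟨hτ, τ[i], List.getElem_mem hi, hiC⟩
  omega

/-- **The Atserias–Dalmau family** (Bonacina 2017, Thm 2.5, first half; Atserias–Dalmau
2008, Thm. 2, construction of Lemma 2): if every resolution refutation of `φ` has width `> w`, the assignments
falsifying no clause of `φ` and no clause narrowly derivable from `φ` form a family that
contains the empty assignment, is closed under sub-assignments, is consistent with `φ`, and
has the extension property below width `w`: an assignment of fewer than `w` literals in the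
family extends, for every variable `x`, by some value of `x` within the family. (Clauses of
`φ` wider than `w` are allowed: a clause falsified by an assignment of `≤ w` literals has
`≤ w` literals.) [cite: AtseriasDalmau2008, Thm. 2 (construction: Lemma 2)] [cite: Bonacina2017, Def. 2.3 and Thm. 2.5] -/
theorem adGood_family (hwidth : ∀ π : List (ResLine ν), IsResRefutation φ π → w < resWidth π) :
    ADGood φ w ∅ ∧
    (∀ α β : Finset (Literal ν), ADGood φ w α → β ⊆ α → ADGood φ w β) ∧
    (∀ α : Finset (Literal ν), ADGood φ w α → ∀ c ∈ φ, ¬ Falsifies α c.toFinset) ∧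
    (∀ α : Finset (Literal ν), ADGood φ w α → α.card < w → ∀ x : ν,
      ∃ b : Bool, ADGood φ w (insert (x, b) α)) := by
  refine ⟨⟨fun c hc hf => ?_, fun C hC hf => ?_⟩, fun α β hα hβα => ?_, fun α hα => hα.1, ?_⟩
  · -- the empty assignment falsifies only the empty clause, a width-0 refutation
    have hc0 : c.toFinset = ∅ := Finset.eq_empty_of_forall_notMem fun l hl => by simpa using hf l hl
    exact not_narrowDerivable_empty hwidth
      (hc0 ▸ narrowDerivable_of_mem hc (by rw [hc0]; exact Nat.zero_le _))
  · have hC0 : C = ∅ := Finset.eq_empty_of_forall_notMem fun l hl => by simpa using hf l hl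
    exact not_narrowDerivable_empty hwidth (hC0 ▸ hC)
  · exact ⟨fun c hc hf => hα.1 c hc (hf.mono hβα), fun C hC hf => hα.2 C hC (hf.mono hβα)⟩
  · intro α hα hαw x
    by_contra hnone
    push Not at hnone
    -- both one-literal extensions falsify some forbidden clause
    have key : ∀ b : Bool, ∃ C : Finset (Literal ν), NarrowDerivable φ w C ∧
        Falsifies (insert (x, b) α) C := by
      intro b
      have h := hnone b
      simp only [ADGood, not_and_or, not_forall, not_not, exists_prop] at h
      rcases h with ⟨c, hc, hf⟩ | ⟨C, hC, hf⟩
      · refine ⟨c.toFinset, narrowDerivable_of_mem hc ?_, hf⟩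
        calc c.toFinset.card ≤ (insert (x, b) α).card := card_le_of_falsifies hf
          _ ≤ α.card + 1 := Finset.card_insert_le _ _
          _ ≤ w := hαw
      · exact ⟨C, hC, hf⟩
    obtain ⟨C₀, hC₀, hf₀⟩ := key false
    obtain ⟨C₁, hC₁, hf₁⟩ := key true
    -- `x ∈ C₀` and `¬x ∈ C₁`, since `α` itself falsifies neither
    have hx₀ : (x, true) ∈ C₀ := by
      by_contra hx
      refine hα.2 C₀ hC₀ fun l hl => ?_
      have := hf₀ l hl
      rw [Finset.mem_insert] at this
      rcases this with h | h
      · exact absurd (by rw [← Literal.negate_negate l, h]; rfl : l = (x, true)) (fun h' => hx (h' ▸ hl))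
      · exact h
    have hx₁ : (x, false) ∈ C₁ := by
      by_contra hx
      refine hα.2 C₁ hC₁ fun l hl => ?_
      have := hf₁ l hl
      rw [Finset.mem_insert] at this
      rcases this with h | h
      · exact absurd (by rw [← Literal.negate_negate l, h]; rfl : l = (x, false)) (fun h' => hx (h' ▸ hl))
      · exact h
    -- the resolvent on `x` is falsified by `α`, hence narrow, hence forbidden: contradiction
    set E := C₀.erase (x, true) ∪ C₁.erase (x, false) with hE
    have hEf : Falsifies α E := by
      intro l hl
      rcases Finset.mem_union.1 hl with hl | hl
      · obtain ⟨hne, hl⟩ := Finset.mem_erase.1 hl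
        have := hf₀ l hl
        rw [Finset.mem_insert] at this
        rcases this with h | h
        · exact absurd (by rw [← Literal.negate_negate l, h]; rfl : l = (x, true)) hne
        · exact h
      · obtain ⟨hne, hl⟩ := Finset.mem_erase.1 hl
        have := hf₁ l hl
        rw [Finset.mem_insert] at this
        rcases this with h | h
        · exact absurd (by rw [← Literal.negate_negate l, h]; rfl : l = (x, false)) hne
        · exact h
    have hEw : E.card ≤ w := (card_le_of_falsifies hEf).trans hαw.le
    exact hα.2 E (narrowDerivable_of_isResolvent ⟨hx₀, hx₁, rfl⟩ hC₀ hC₁ hEw) hEf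

end ADFamily


/-! ### Option-free access to lines -/

/-- The line of `π` at position `k`, with the harmless junk value `⟨∅, initial⟩` out of
range (the walk needs the rule, not only the clause; `(lineD π k).clause` is
`ResolutionRecords.lineClause π k`, see `lineClause_eq_lineD`). [folklore] -/
def lineD (π : List (ResLine ν)) (k : ℕ) : ResLine ν :=
  π[k]?.getD ⟨∅, .initial⟩

/-- Bridge to `ResolutionRecords.lineClause`. [folklore] -/
theorem lineClause_eq_lineD (π : List (ResLine ℕ)) (k : ℕ) : lineClause π k = (lineD π k).clause := by
  unfold lineClause lineD
  cases π[k]? <;> rfl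

omit [DecidableEq ν] in
/-- In range, `lineD` is the line. [folklore] -/
theorem lineD_eq {π : List (ResLine ν)} {k : ℕ} (hk : k < π.length) : lineD π k = π[k] := by
  simp [lineD, List.getElem?_eq_getElem hk]

omit [DecidableEq ν] in
/-- Out of range, `lineD` is the junk line `⟨∅, initial⟩`. [folklore] -/
theorem lineD_of_le {π : List (ResLine ν)} {k : ℕ} (hk : π.length ≤ k) :
    lineD π k = ⟨∅, .initial⟩ := by
  simp [lineD, List.getElem?_eq_none hk]

section Valid

variable {φ : CNF ν} {π : List (ResLine ν)}

/-- Unpacking validity of a resolution line. [Krajíček 2019, §5.1] [folklore] -/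
theorem IsResDerivation.of_resolve (hπ : IsResDerivation φ π) {k : ℕ} (hk : k < π.length)
    {i j : ℕ} {v : ν} (hr : (lineD π k).rule = .resolve i j v) :
    i < k ∧ j < k ∧ IsResolvent (lineD π i).clause (lineD π j).clause v (lineD π k).clause := by
  have hv := hπ k hk
  rw [lineD_eq hk] at hr
  unfold IsValidResLine at hv
  rw [hr] at hv
  obtain ⟨hi, hj, hres⟩ := hv
  have hik : i < k := (by simpa [List.length_take] using hi : i < k ∧ i < π.length).1
  have hjk : j < k := (by simpa [List.length_take] using hj : j < k ∧ j < π.length).1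
  rw [List.getElem_take, List.getElem_take] at hres
  refine ⟨hik, hjk, ?_⟩
  rwa [lineD_eq (hik.trans hk), lineD_eq (hjk.trans hk), lineD_eq hk]

/-- Unpacking validity of a weakening line. [Krajíček 2019, §5.4] [folklore] -/
theorem IsResDerivation.of_weaken (hπ : IsResDerivation φ π) {k : ℕ} (hk : k < π.length)
    {i : ℕ} (hr : (lineD π k).rule = .weaken i) :
    i < k ∧ (lineD π i).clause ⊆ (lineD π k).clause := by
  have hv := hπ k hk
  rw [lineD_eq hk] at hr
  unfold IsValidResLine at hv
  rw [hr] at hv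
  obtain ⟨hi, hsub⟩ := hv
  have hik : i < k := (by simpa [List.length_take] using hi : i < k ∧ i < π.length).1
  rw [List.getElem_take] at hsub
  refine ⟨hik, ?_⟩
  rwa [lineD_eq (hik.trans hk), lineD_eq hk]

/-- Unpacking validity of an initial line. [Krajíček 2019, §5.1] [folklore] -/
theorem IsResDerivation.of_initial (hπ : IsResDerivation φ π) {k : ℕ} (hk : k < π.length)
    (hr : (lineD π k).rule = .initial) : (lineD π k).clause ∈ φ.clauseFinsets := by
  have hv := hπ k hk
  rw [lineD_eq hk] at hr
  unfold IsValidResLine at hv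
  rw [hr] at hv
  rwa [lineD_eq hk]

end Valid

/-! ### The walk driven by Delayer's answers -/

/-- One move of the Prover strategy read off from `π` against the Delayer `ans` (the record
is the current clause, the query is its pivot): from a resolution line go to the premise
containing the literal falsified by the answer, from a weakening line to its premise, and stay
at initial lines (and out of range). Convention: `ans` is handed the CLAUSE `C` (its literals
are the ones the record makes false; the record as a set of true literals is
`C.image Literal.negate`, cf. `Falsifies`), and the answer `q` to the pivot `v` adds the literal
`(v, !q)` to the next clause (`clause_succ_subset`); a Delayer given as a family of true-literal
assignments (`ADGood`) must therefore negate. [Pudlák 2000, §2; Bonacina 2017, proof of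
Thm 8.5] [cite: Bonacina2017, Thm 8.5 (proof sketch)] -/
def nextLine (π : List (ResLine ν)) (ans : Finset (Literal ν) → ν → Bool) (k : ℕ) : ℕ :=
  match (lineD π k).rule with
  | .resolve i j v => if ans (lineD π k).clause v then j else i
  | .weaken i => i
  | .initial => k

/-- The play (sequence of visited lines) of that Prover strategy against `ans`, started at
line `r₀`. [Pudlák 2000, §2; Bonacina 2017, Thm 8.5] [cite: Bonacina2017, Thm 8.5] -/
def trace (π : List (ResLine ν)) (ans : Finset (Literal ν) → ν → Bool) (r₀ : ℕ) : ℕ → ℕ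
  | 0 => r₀
  | t + 1 => nextLine π ans (trace π ans r₀ t)

section Plays

variable {φ : CNF ν} {π : List (ResLine ν)} {ans : Finset (Literal ν) → ν → Bool} {r₀ : ℕ}

omit [DecidableEq ν] in
/-- The play starts at `r₀`. [folklore] -/
@[simp] theorem trace_zero : trace π ans r₀ 0 = r₀ := rfl

omit [DecidableEq ν] in
/-- The play advances by `nextLine`. [folklore] -/
@[simp] theorem trace_succ (t : ℕ) :
    trace π ans r₀ (t + 1) = nextLine π ans (trace π ans r₀ t) := rfl

omit [DecidableEq ν] in
/-- `nextLine` at a resolution line follows Delayer's answer. [Pudlák 2000, §2] [folklore] -/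
theorem nextLine_of_resolve {k i j : ℕ} {v : ν} (hr : (lineD π k).rule = .resolve i j v) :
    nextLine π ans k = if ans (lineD π k).clause v then j else i := by
  simp [nextLine, hr]

omit [DecidableEq ν] in
/-- `nextLine` at a weakening line goes to its premise. [folklore] -/
theorem nextLine_of_weaken {k i : ℕ} (hr : (lineD π k).rule = .weaken i) : nextLine π ans k = i := by
  simp [nextLine, hr]

omit [DecidableEq ν] in
/-- `nextLine` stays at initial lines. [folklore] -/
theorem nextLine_of_initial {k : ℕ} (hr : (lineD π k).rule = .initial) : nextLine π ans k = k := by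
  simp [nextLine, hr]

/-- Premises precede conclusions, so the walk never increases. [folklore] -/
theorem nextLine_le (hπ : IsResDerivation φ π) (k : ℕ) : nextLine π ans k ≤ k := by
  by_cases hk : k < π.length
  · cases hr : (lineD π k).rule with
    | initial => rw [nextLine_of_initial hr]
    | resolve i j v =>
      rw [nextLine_of_resolve hr]
      obtain ⟨hi, hj, -⟩ := hπ.of_resolve hk hr
      split <;> omega
    | weaken i =>
      rw [nextLine_of_weaken hr]
      exact (hπ.of_weaken hk hr).1.le
  · rw [nextLine_of_initial (by rw [lineD_of_le (not_lt.1 hk)])]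

/-- At a non-initial line the walk moves strictly down. [folklore] -/
theorem nextLine_lt (hπ : IsResDerivation φ π) {k : ℕ} (hk : k < π.length)
    (hne : (lineD π k).rule ≠ .initial) : nextLine π ans k < k := by
  cases hr : (lineD π k).rule with
  | initial => exact absurd hr hne
  | resolve i j v =>
    rw [nextLine_of_resolve hr]
    obtain ⟨hi, hj, -⟩ := hπ.of_resolve hk hr
    split <;> omega
  | weaken i =>
    rw [nextLine_of_weaken hr]
    exact (hπ.of_weaken hk hr).1

/-- The play never goes above its starting line. [folklore] -/
theorem trace_le (hπ : IsResDerivation φ π) (t : ℕ) : trace π ans r₀ t ≤ r₀ := by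
  induction t with
  | zero => simp
  | succ t ih => exact (nextLine_le hπ _).trans ih

/-- The play stays inside `π`. [folklore] -/
theorem trace_lt_length (hπ : IsResDerivation φ π) (hr₀ : r₀ < π.length) (t : ℕ) :
    trace π ans r₀ t < π.length :=
  (trace_le hπ t).trans_lt hr₀

/-- The walk reaches an initial line. [Pudlák 2000, §2] [folklore] -/
theorem exists_trace_initial (hπ : IsResDerivation φ π) (hr₀ : r₀ < π.length) :
    ∃ t, (lineD π (trace π ans r₀ t)).rule = .initial := by
  by_contra h
  push Not at h
  have key : ∀ t, trace π ans r₀ t + t ≤ r₀ := by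
    intro t
    induction t with
    | zero => simp
    | succ t ih =>
      have := nextLine_lt (ans := ans) hπ (trace_lt_length hπ hr₀ t) (h t)
      rw [trace_succ]
      omega
  have := key (r₀ + 1)
  omega

/-- The premise structure along the play is a DAG path of `π` as long as no initial line has
been reached. [Krajíček 2019, §5.1 (paths of the proof graph)] [folklore] -/
theorem isDagPath_trace (hπ : IsResDerivation φ π) (hr₀ : r₀ < π.length) {t : ℕ}
    (ht : ∀ s < t, (lineD π (trace π ans r₀ s)).rule ≠ .initial) :
    IsDagPath (π.map ResLine.premises) ((List.range (t + 1)).map (trace π ans r₀)) := by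
  refine ⟨fun i hi => ?_, ?_⟩
  · obtain ⟨s, -, rfl⟩ := List.mem_map.1 hi
    rw [List.length_map]
    exact trace_lt_length hπ hr₀ s
  · rw [List.isChain_map, List.isChain_range_succ]
    intro s hs
    have hlt := trace_lt_length (ans := ans) hπ hr₀ s
    rw [List.getD_eq_getElem?_getD, List.getElem?_map, List.getElem?_eq_getElem hlt, Option.map_some,
      Option.getD_some, show π[trace π ans r₀ s] = lineD π (trace π ans r₀ s) from (lineD_eq hlt).symm]
    change nextLine π ans _ ∈ (lineD π (trace π ans r₀ s)).rule.premises
    cases hr : (lineD π (trace π ans r₀ s)).rule with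
    | initial => exact absurd hr (ht s hs)
    | resolve i j v =>
      rw [nextLine_of_resolve hr]
      split <;> simp [ResRule.premises]
    | weaken i =>
      rw [nextLine_of_weaken hr]
      simp [ResRule.premises]

/-- The pivot queried at step `s` of the play (`none` at weakening / initial lines).
[Pudlák 2000, §2] [folklore] -/
def pivotAt (π : List (ResLine ν)) (ans : Finset (Literal ν) → ν → Bool) (r₀ s : ℕ) : Option ν :=
  (lineD π (trace π ans r₀ s)).rule.pivot?

omit [DecidableEq ν] in
/-- The pivot at a resolution step. [folklore] -/
theorem pivotAt_of_resolve {s i j : ℕ} {v : ν}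
    (hr : (lineD π (trace π ans r₀ s)).rule = .resolve i j v) : pivotAt π ans r₀ s = some v := by
  simp [pivotAt, hr, ResRule.pivot?]

/-- The pivots met along the path of a play are the queried variables, in order. [Krajíček 2019, §5.6] [folklore] -/
theorem pivotsAlong_trace (hπ : IsResDerivation φ π) (hr₀ : r₀ < π.length) (t : ℕ) :
    pivotsAlong π ((List.range (t + 1)).map (trace π ans r₀)) =
      (List.range (t + 1)).filterMap (pivotAt π ans r₀) := by
  rw [pivotsAlong, List.filterMap_map]
  congr 1
  funext s
  simp only [Function.comp, pivotAt, lineD, List.getElem?_eq_getElem (trace_lt_length hπ hr₀ s)]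
  rfl

/-- **Read-once**: in a regular refutation, two distinct steps of a play (before an initial
line is reached) never query the same variable. [Bonacina 2017, Thm 8.5 ("if `π` is
`δ`-regular … at most `δn` variables re-queried", `δ = 0`)] [cite: Bonacina2017, Thm 8.5] -/
theorem pivotAt_ne (hπ : IsResDerivation φ π) (hreg : IsRegular π) (hr₀ : r₀ < π.length)
    {s₁ s₂ t : ℕ} (h12 : s₁ < s₂) (h2t : s₂ ≤ t)
    (ht : ∀ s < t, (lineD π (trace π ans r₀ s)).rule ≠ .initial) {v : ν}
    (h1 : pivotAt π ans r₀ s₁ = some v) (h2 : pivotAt π ans r₀ s₂ = some v) : False := by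
  have hnd := hreg _ (isDagPath_trace hπ hr₀ ht)
  rw [pivotsAlong_trace hπ hr₀, show t + 1 = s₂ + (t + 1 - s₂) by omega, List.range_add,
    List.filterMap_append, List.nodup_append] at hnd
  refine hnd.2.2 v (List.mem_filterMap.2 ⟨s₁, List.mem_range.2 h12, h1⟩) v
    (List.mem_filterMap.2 ⟨s₂ + 0, List.mem_map.2 ⟨0, List.mem_range.2 (by omega), rfl⟩, ?_⟩) rfl
  simpa using h2

/-- **Persistence of literals along a play**: a literal of the clause at step `t` is either
already in the clause at an earlier step `s`, or it is the pivot literal removed at some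
resolution step `u ∈ [s, t)` — namely `v^{1-q}` where `v` is the pivot and `q` Delayer's
answer at `u`. [Bonacina 2017, proof of Thm 8.5 ("each play corresponds to a path in `π`")]
[folklore] -/
theorem persist (hπ : IsResDerivation φ π) (hr₀ : r₀ < π.length) {s d : ℕ}
    (ht : ∀ u < s + d, (lineD π (trace π ans r₀ u)).rule ≠ .initial) {m : Literal ν}
    (hm : m ∈ (lineD π (trace π ans r₀ (s + d))).clause) :
    m ∈ (lineD π (trace π ans r₀ s)).clause ∨
      ∃ u, s ≤ u ∧ u < s + d ∧ ∃ i j v, (lineD π (trace π ans r₀ u)).rule = .resolve i j v ∧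
        m = (v, !ans (lineD π (trace π ans r₀ u)).clause v) := by
  induction d with
  | zero => exact Or.inl hm
  | succ d ih =>
    have ht' : ∀ u < s + d, (lineD π (trace π ans r₀ u)).rule ≠ .initial :=
      fun u hu => ht u (by omega)
    have hk := trace_lt_length (ans := ans) hπ hr₀ (s + d)
    -- one step back from `s + d + 1` to `s + d`
    have step : m ∈ (lineD π (trace π ans r₀ (s + d))).clause ∨
        ∃ i j v, (lineD π (trace π ans r₀ (s + d))).rule = .resolve i j v ∧
          m = (v, !ans (lineD π (trace π ans r₀ (s + d))).clause v) := by
      rw [show s + (d + 1) = s + d + 1 by omega, trace_succ] at hm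
      cases hr : (lineD π (trace π ans r₀ (s + d))).rule with
      | initial => exact absurd hr (ht (s + d) (by omega))
      | weaken i =>
        rw [nextLine_of_weaken hr] at hm
        exact Or.inl ((hπ.of_weaken hk hr).2 hm)
      | resolve i j v =>
        obtain ⟨-, -, hC, hD, hE⟩ := hπ.of_resolve hk hr
        rw [nextLine_of_resolve hr] at hm
        cases hq : ans (lineD π (trace π ans r₀ (s + d))).clause v
        · -- answer `false`: go to the premise containing `v`
          rw [hq] at hm
          simp only [Bool.false_eq_true, ↓reduceIte] at hm
          by_cases hmv : m = (v, true)
          · exact Or.inr ⟨i, j, v, rfl, by rw [hq]; simpa using hmv⟩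
          · left
            rw [hE]
            exact Finset.mem_union_left _ (Finset.mem_erase.2 ⟨hmv, hm⟩)
        · rw [hq] at hm
          simp only [↓reduceIte] at hm
          by_cases hmv : m = (v, false)
          · exact Or.inr ⟨i, j, v, rfl, by rw [hq]; simpa using hmv⟩
          · left
            rw [hE]
            exact Finset.mem_union_right _ (Finset.mem_erase.2 ⟨hmv, hm⟩)
    rcases step with hm' | ⟨i, j, v, hr, hmv⟩
    · rcases ih ht' hm' with h | ⟨u, hsu, hut, hu⟩
      · exact Or.inl h
      · exact Or.inr ⟨u, hsu, by omega, hu⟩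
    · exact Or.inr ⟨s + d, by omega, by omega, i, j, v, hr, hmv⟩

/-- In a regular refutation, along a play started at the empty clause, the pivot of a
resolution step does not occur in its own clause (otherwise it would be resolved twice on the
path to the empty clause). [Bonacina 2017, §8.2 ("Prover queries some variable
`x ∉ dom(α_i)`")] [folklore] -/
theorem pivot_not_mem_clause (hπ : IsResDerivation φ π) (hreg : IsRegular π)
    (hr₀ : r₀ < π.length) (hroot : (lineD π r₀).clause = ∅) {t : ℕ}
    (ht : ∀ u < t, (lineD π (trace π ans r₀ u)).rule ≠ .initial) {i j : ℕ} {v : ν}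
    (hr : (lineD π (trace π ans r₀ t)).rule = .resolve i j v) (b : Bool) :
    (v, b) ∉ (lineD π (trace π ans r₀ t)).clause := by
  intro hm
  rcases persist (s := 0) (d := t) hπ hr₀ (by simpa using ht) (by simpa using hm) with h | ⟨u, -, hut, i', j', v', hr', hmv⟩
  · simp [hroot] at h
  · have hv : v' = v := (Prod.ext_iff.1 hmv).1.symm
    subst hv
    exact pivotAt_ne hπ hreg hr₀ (by simpa using hut) le_rfl ht (pivotAt_of_resolve hr') (pivotAt_of_resolve hr)

/-- In a regular refutation, along a play started at the empty clause, no clause contains a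
complementary pair of literals. [Bonacina 2017, §8.2 (records `α_C` are assignments)]
[folklore] -/
theorem not_mem_clause_compl (hπ : IsResDerivation φ π) (hreg : IsRegular π)
    (hr₀ : r₀ < π.length) (hroot : (lineD π r₀).clause = ∅) {t : ℕ}
    (ht : ∀ u < t, (lineD π (trace π ans r₀ u)).rule ≠ .initial) (x : ν) :
    ¬ ((x, true) ∈ (lineD π (trace π ans r₀ t)).clause ∧
      (x, false) ∈ (lineD π (trace π ans r₀ t)).clause) := by
  rintro ⟨h₁, h₂⟩
  rcases persist (s := 0) (d := t) hπ hr₀ (by simpa using ht) (by simpa using h₁) with h | ⟨u₁, -, hu₁, i₁, j₁, v₁, hr₁, hm₁⟩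
  · simp [hroot] at h
  rcases persist (s := 0) (d := t) hπ hr₀ (by simpa using ht) (by simpa using h₂) with h | ⟨u₂, -, hu₂, i₂, j₂, v₂, hr₂, hm₂⟩
  · simp [hroot] at h
  obtain ⟨hv₁, hq₁⟩ := Prod.ext_iff.1 hm₁
  obtain ⟨hv₂, hq₂⟩ := Prod.ext_iff.1 hm₂
  simp only at hv₁ hv₂ hq₁ hq₂
  subst hv₁
  have hne : u₁ ≠ u₂ := by
    rintro rfl
    rw [hr₁] at hr₂
    cases hr₂
    rw [← hq₁] at hq₂
    simp at hq₂
  rcases Nat.lt_or_gt_of_ne hne with h | h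
  · exact pivotAt_ne hπ hreg hr₀ h hu₂.le (fun s hs => ht s (by omega))
      (pivotAt_of_resolve hr₁) (by rw [pivotAt_of_resolve hr₂, hv₂])
  · exact pivotAt_ne hπ hreg hr₀ h hu₁.le (fun s hs => ht s (by omega))
      (by rw [pivotAt_of_resolve hr₂, hv₂]) (pivotAt_of_resolve hr₁)

/-- Over `ℕ`, records along a play from the empty clause of a regular refutation are
consistent in the sense of `ResolutionRecords.IsNonTaut`. [Bonacina 2017, §8.2] [folklore] -/
theorem isNonTaut_trace_clause {φ : CNF ℕ} {π : List (ResLine ℕ)}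
    {ans : Finset (Literal ℕ) → ℕ → Bool} {r₀ : ℕ} (hπ : IsResDerivation φ π)
    (hreg : IsRegular π) (hr₀ : r₀ < π.length) (hroot : (lineD π r₀).clause = ∅) {t : ℕ}
    (ht : ∀ u < t, (lineD π (trace π ans r₀ u)).rule ≠ .initial) :
    IsNonTaut (lineD π (trace π ans r₀ t)).clause :=
  fun x => not_mem_clause_compl hπ hreg hr₀ hroot ht x

/-- Every literal of the clause at step `t` of a play from the empty clause was put there by
an earlier query: it is `v^{1-q}` for the pivot `v` and answer `q` of an earlier resolution
step (records only contain answered values). [Bonacina 2017, §8.2] [folklore] -/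
theorem exists_query_of_mem (hπ : IsResDerivation φ π) (hr₀ : r₀ < π.length)
    (hroot : (lineD π r₀).clause = ∅) {t : ℕ}
    (ht : ∀ u < t, (lineD π (trace π ans r₀ u)).rule ≠ .initial) {m : Literal ν}
    (hm : m ∈ (lineD π (trace π ans r₀ t)).clause) :
    ∃ u, u < t ∧ ∃ i j v, (lineD π (trace π ans r₀ u)).rule = .resolve i j v ∧
      m = (v, !ans (lineD π (trace π ans r₀ u)).clause v) := by
  rcases persist (s := 0) (d := t) hπ hr₀ (by simpa using ht) (by simpa using hm) with h | ⟨u, -, hut, hu⟩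
  · simp [hroot] at h
  · exact ⟨u, by simpa using hut, hu⟩

/-- One step of a play only adds the answered literal: the next clause is contained in the
current one plus `v^{1-q}` (resolution step) or in the current one (weakening step).
[Bonacina 2017, §8.2 ("`α_{i+1} ⊆ α_i ∪ {x = b}`")] [folklore] -/
theorem clause_succ_subset (hπ : IsResDerivation φ π) (hr₀ : r₀ < π.length) (t : ℕ) :
    (∃ i j v, (lineD π (trace π ans r₀ t)).rule = .resolve i j v ∧
        (lineD π (trace π ans r₀ (t + 1))).clause ⊆
          insert (v, !ans (lineD π (trace π ans r₀ t)).clause v) (lineD π (trace π ans r₀ t)).clause) ∨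
      (lineD π (trace π ans r₀ (t + 1))).clause ⊆ (lineD π (trace π ans r₀ t)).clause := by
  have hk := trace_lt_length (ans := ans) hπ hr₀ t
  rw [trace_succ]
  cases hr : (lineD π (trace π ans r₀ t)).rule with
  | initial => right; rw [nextLine_of_initial hr]
  | weaken i => right; rw [nextLine_of_weaken hr]; exact (hπ.of_weaken hk hr).2
  | resolve i j v =>
    left
    refine ⟨i, j, v, rfl, ?_⟩
    obtain ⟨-, -, hC, hD, hE⟩ := hπ.of_resolve hk hr
    rw [nextLine_of_resolve hr]
    cases hq : ans (lineD π (trace π ans r₀ t)).clause v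
    · simp only [Bool.false_eq_true, ↓reduceIte, Bool.not_false]
      intro m hm
      by_cases hmv : m = (v, true)
      · rw [hmv]; exact Finset.mem_insert_self _ _
      · rw [hE]; exact Finset.mem_insert_of_mem (Finset.mem_union_left _ (Finset.mem_erase.2 ⟨hmv, hm⟩))
    · simp only [↓reduceIte, Bool.not_true]
      intro m hm
      by_cases hmv : m = (v, false)
      · rw [hmv]; exact Finset.mem_insert_self _ _
      · rw [hE]; exact Finset.mem_insert_of_mem (Finset.mem_union_right _ (Finset.mem_erase.2 ⟨hmv, hm⟩))

end Plays


/-! ### Records: the variable set of a clause -/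

section Records

/-- The finite SET of variables occurring in a set-clause `E` — the Finset form of
`ResolutionRecords.MemVar` (`mem_lvars_iff_memVar`), needed where domains of records are
filtered and counted (blocks, Hamming balls). [Bonacina 2017, §8.2 (`dom(α_C) = var(C)`)]
[folklore] -/
def lvars (E : Finset (Literal ℕ)) : Finset ℕ := E.image Prod.fst

/-- Membership in the variable set. [folklore] -/
theorem mem_lvars {E : Finset (Literal ℕ)} {v : ℕ} : v ∈ lvars E ↔ ∃ b, (v, b) ∈ E := by
  simp [lvars]

/-- Bridge to `ResolutionRecords.MemVar`. [folklore] -/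
theorem mem_lvars_iff_memVar {E : Finset (Literal ℕ)} {v : ℕ} : v ∈ lvars E ↔ MemVar E v := by
  rw [mem_lvars, MemVar]
  constructor
  · rintro ⟨b, hb⟩; cases b; exacts [Or.inr hb, Or.inl hb]
  · rintro (h | h); exacts [⟨true, h⟩, ⟨false, h⟩]

/-- The empty clause has no variables. [folklore] -/
@[simp] theorem lvars_empty : lvars (∅ : Finset (Literal ℕ)) = ∅ := by simp [lvars]

/-- Variables of a clause with one more literal. [folklore] -/
theorem lvars_insert (v : ℕ) (c : Bool) (E : Finset (Literal ℕ)) :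
    lvars (insert (v, c) E) = insert v (lvars E) := by
  simp [lvars, Finset.image_insert]

/-- Variables are monotone. [folklore] -/
theorem lvars_mono {E E' : Finset (Literal ℕ)} (h : E' ⊆ E) : lvars E' ⊆ lvars E :=
  Finset.image_subset_image h

/-- Assigning a fresh variable keeps a record consistent (`IsNonTaut` of
`ResolutionRecords.lean`). [folklore] -/
theorem IsNonTaut.insert {E : Finset (Literal ℕ)} (h : IsNonTaut E) {v : ℕ} (hv : v ∉ lvars E)
    (c : Bool) : IsNonTaut (insert (v, c) E) := by
  intro u ⟨h₁, h₂⟩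
  rw [Finset.mem_insert] at h₁ h₂
  rcases h₁ with h₁ | h₁ <;> rcases h₂ with h₂ | h₂
  · have := (Prod.ext_iff.1 h₁).2; have := (Prod.ext_iff.1 h₂).2; simp_all
  · obtain ⟨rfl, -⟩ := Prod.ext_iff.1 h₁; exact hv (mem_lvars.2 ⟨false, h₂⟩)
  · obtain ⟨rfl, -⟩ := Prod.ext_iff.1 h₂; exact hv (mem_lvars.2 ⟨true, h₁⟩)
  · exact h u ⟨h₁, h₂⟩

end Records

end Literature.Computability.MetaComplexity
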